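import Summits.ABC.ABC.Theses.RibetTakahashiSplit
import Literature.NumberTheory.EllipticCurves.SzpiroOfAbcProofs
import Literature.NumberTheory.DiophantineGeometry.ConductorRadicalProofs

/-!
# The valuation-product crux `ManyPrimeValuationProduct` under Szpiro-type hypotheses
# (support file for crux stmt-ABC-1561 of route `RibetTakahashiSplit`)

Write `T(E) := ∏_{p ∥ N_E} ord_p(Δ_min(E))` for the geometric Tamagawa product of the route
(product over the prime factors `p` of the conductor `N_E` with `p² ∤ N_E`).  The crux r2
(`ManyPrimeValuationProduct`, stmt-ABC-1561) and its few-prime twin r4 (`FewPrimeValuationProduct`,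
stmt-ABC-1563) assert `T(E) ≤ C_ε N_E^ε` on the curves semistable away from `2`.

This file records, sorry-free, the STRUCTURAL position of the crux inside the route and the summit
(asked for by the three crux triagers of round 1, `Cruxes/ManyPrimeValuationProduct/TRIAGE-r1-*.md`,
and certified informally by the crux disprover, `Disproof.lean` v4 §1–§2):

* §1 `prod_factorization_le_rpow` — the valuation product of an integer is sub-polynomial:
  for every `δ > 0` there is `A_δ` with `∏_{p ∈ S} v_p(n) ≤ A_δ · n^δ` for all `n ≠ 0` and all sets
  `S` of prime factors of `n` (per prime, `k ≤ (δ log p)⁻¹ p^{kδ}`, and the factor is `1` once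
  `p ≥ e^{1/δ}`).
* §2 `valuationProduct_le_rpow_minimalDiscriminantNorm` — hence `T(E) ≤ A_δ |Δ_min(E)|^δ`
  (the conductor and the minimal discriminant have the same prime factors).
* §3 `valuationProduct_le_of_polySzpiro` — ANY polynomial Szpiro bound `|Δ_min| ≤ C N^K` on a class
  of curves gives `T(E) ≤ C'_ε N^ε` on that class.
* §4 `polySzpiro_of_weightedSzpiroBound` — the rank-3 crux r3′ (`WeightedSzpiroBound`,
  stmt-ABC-3272) ALONE gives polynomial Szpiro `|Δ_min| ≤ C N^{14}` on the curves semistable away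
  from `2` (feed `T ≤ A |Δ_min|^{1/14}` into r3′ at `ε = 1` and absorb `|Δ_min|^{1/2}`).
* §5 THE BOOTSTRAP `weightedSzpiroBound_bootstrap : WeightedSzpiroBound →
  ManyPrimeValuationProduct ∧ FewPrimeValuationProduct` — so r2 and r4 are NOT load-bearing for the
  route: its deciding theorem can be re-cut as `WeightedSzpiroBound → Assembly → ABC` (the sibling
  file `RibetTakahashiSplitWeightedSzpiroBoundAbc.lean`, `WeightedSzpiroBound.iff_abc` /
  `.assembly_of_crux`, reaches the same conclusion THROUGH the summit; the bootstrap here is the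
  direct arithmetic route r3′ ⇒ polynomial Szpiro ⇒ r2 ∧ r4 and does not pass through `ABC`).
* §6 `manyPrime_and_fewPrime_of_szpiro`, `manyPrime_and_fewPrime_of_abc` — Szpiro's conjecture (at `ε = 1`) and hence the
  summit `ABC` (through the tree's discharged `szpiro_of_abcLe_holds`) imply the crux: no
  truth-level refutation of r2 exists short of `¬ ABC`.

Everything is elementary given the tree's arithmetic of global minimal models
(`exists_baseChange_int_forall_isMinimalAt`, `conductorNorm_smul_rat`,
`minimalDiscriminantNorm_smul_rat`, `minimalDiscriminantNorm_eq_natAbs_holds`,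
`radical_conductorNorm_eq_holds`, all PROVED).  No new definitions.
-/

-- `Summit.<Summit>.<Problem>` is the mandated summit-side namespace (CONVENTIONS §2); for the
-- single-conjunct summit `ABC` the two coincide, so the duplicate `ABC.ABC` is deliberate.
set_option linter.dupNamespace false

namespace Summit.ABC.ABC.Theorems

open scoped Classical
open Finset
open Summit.ABC.ABC.Theses.RibetTakahashiSplit
open Literature.NumberTheory.EllipticCurves (SzpiroConjecture szpiro_of_abcLe_holds)

namespace ManyPrimeValuationProduct

/-! ### §1 The valuation product of an integer is sub-polynomial -/

/-- `k ≤ t⁻¹ e^{tk}` for `t > 0` (from `x + 1 ≤ eˣ`). [folklore] -/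
theorem natCast_le_inv_mul_exp {t : ℝ} (ht : 0 < t) (k : ℕ) :
    (k : ℝ) ≤ t⁻¹ * Real.exp (t * k) := by
  have h := Real.add_one_le_exp (t * k)
  rw [le_inv_mul_iff₀ ht]
  linarith

/-- Per-prime bound: for `δ > 0`, `p ≥ 2` and every `k`,
`k ≤ max(1, (δ log p)⁻¹) · (p^k)^δ`. [folklore] -/
theorem natCast_le_max_mul_rpow {δ : ℝ} (hδ : 0 < δ) {p : ℕ} (hp : 2 ≤ p) (k : ℕ) :
    (k : ℝ) ≤ max 1 (δ * Real.log p)⁻¹ * (((p ^ k : ℕ) : ℝ) ^ δ) := by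
  have hp0 : (0 : ℝ) < p := by exact_mod_cast (by omega : 0 < p)
  have hlogp : 0 < Real.log p := Real.log_pos (by exact_mod_cast (by omega : 1 < p))
  have ht : 0 < δ * Real.log p := mul_pos hδ hlogp
  have h1 := natCast_le_inv_mul_exp ht k
  have hexp : (((p ^ k : ℕ) : ℝ) ^ δ) = Real.exp (δ * Real.log p * k) := by
    rw [Nat.cast_pow, ← Real.rpow_natCast, ← Real.rpow_mul hp0.le, Real.rpow_def_of_pos hp0]
    congr 1
    ring
  rw [hexp]
  exact h1.trans (mul_le_mul_of_nonneg_right (le_max_right _ _) (Real.exp_pos _).le)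

/-- **The valuation product of an integer is sub-polynomial.** For every `δ > 0` there is
`A > 0` such that `∏_{p ∈ S} v_p(n) ≤ A · n^δ` for every `n ≠ 0` and every set `S` of prime
factors of `n`. Proof: per prime `v ≤ max(1,(δ log p)⁻¹) (p^v)^δ`; the factor is `1` for
`p > e^{1/δ}`, so `A = ∏_{q ≤ ⌈e^{1/δ}⌉} max(1,(δ log q)⁻¹)`, and `∏_{p ∈ S} p^{v_p} ∣ n`.
(Disproof.lean v4 §1 of the crux disprover, re-derived.) [folklore] -/
theorem prod_factorization_le_rpow {δ : ℝ} (hδ : 0 < δ) :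
    ∃ A : ℝ, 0 < A ∧ ∀ n : ℕ, n ≠ 0 → ∀ S ⊆ n.primeFactors,
      ((∏ p ∈ S, n.factorization p : ℕ) : ℝ) ≤ A * (n : ℝ) ^ δ := by
  set P : ℕ := ⌈Real.exp δ⁻¹⌉₊ + 1 with hP
  set M : ℕ → ℝ := fun p => max 1 (δ * Real.log p)⁻¹ with hM
  have hM1 : ∀ q, 1 ≤ M q := fun q => le_max_left _ _
  refine ⟨∏ q ∈ Finset.range P, M q,
    Finset.prod_pos (fun q _ => lt_of_lt_of_le one_pos (hM1 q)), ?_⟩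
  intro n hn S hS
  -- primes beyond the threshold contribute the factor `1`
  have hMbig : ∀ p : ℕ, P ≤ p → M p = 1 := by
    intro p hp
    have h1 : Real.exp δ⁻¹ ≤ p := by
      have h' : (⌈Real.exp δ⁻¹⌉₊ : ℝ) ≤ p := by exact_mod_cast (by omega : ⌈Real.exp δ⁻¹⌉₊ ≤ p)
      exact (Nat.le_ceil (Real.exp δ⁻¹)).trans h'
    have h2 : δ⁻¹ ≤ Real.log p := by
      rw [← Real.log_exp δ⁻¹]
      exact Real.log_le_log (Real.exp_pos _) h1
    have h3 : 1 ≤ δ * Real.log p := (inv_le_iff_one_le_mul₀' hδ).mp h2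
    exact max_eq_left (inv_le_one_of_one_le₀ h3)
  -- pointwise bound and its product
  have hpt : ∀ p ∈ S, ((n.factorization p : ℕ) : ℝ) ≤
      M p * (((p ^ n.factorization p : ℕ) : ℝ) ^ δ) :=
    fun p hp => natCast_le_max_mul_rpow hδ (Nat.prime_of_mem_primeFactors (hS hp)).two_le _
  have hprod : ((∏ p ∈ S, n.factorization p : ℕ) : ℝ) ≤
      (∏ p ∈ S, M p) * ∏ p ∈ S, (((p ^ n.factorization p : ℕ) : ℝ) ^ δ) := by
    rw [Nat.cast_prod, ← Finset.prod_mul_distrib]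
    exact Finset.prod_le_prod (fun p _ => Nat.cast_nonneg _) hpt
  -- the constant part
  have hMS : ∏ p ∈ S, M p ≤ ∏ q ∈ Finset.range P, M q := by
    have hsplit := Finset.prod_filter_mul_prod_filter_not S (fun p => p < P) M
    have h2 : ∏ p ∈ S.filter (fun p => ¬ p < P), M p = 1 :=
      Finset.prod_eq_one (fun p hp => hMbig p (not_lt.mp (Finset.mem_filter.mp hp).2))
    rw [h2, mul_one] at hsplit
    rw [← hsplit]
    have hsub : S.filter (fun p => p < P) ⊆ Finset.range P := fun p hp =>
      Finset.mem_range.mpr (Finset.mem_filter.mp hp).2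
    rw [← Finset.prod_sdiff hsub]
    have h1 : (1 : ℝ) ≤ ∏ q ∈ Finset.range P \ S.filter (fun p => p < P), M q := by
      calc (1 : ℝ) = ∏ q ∈ Finset.range P \ S.filter (fun p => p < P), (1 : ℝ) :=
            Finset.prod_const_one.symm
        _ ≤ _ := Finset.prod_le_prod (fun _ _ => zero_le_one) (fun q _ => hM1 q)
    have h0 : 0 ≤ ∏ q ∈ S.filter (fun p => p < P), M q :=
      Finset.prod_nonneg (fun q _ => zero_le_one.trans (hM1 q))
    calc ∏ q ∈ S.filter (fun p => p < P), M q
        = 1 * ∏ q ∈ S.filter (fun p => p < P), M q := (one_mul _).symm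
      _ ≤ _ := mul_le_mul_of_nonneg_right h1 h0
  -- the power part: `∏_{p ∈ S} p ^ v_p ∣ n`
  have hfull : ∏ p ∈ n.primeFactors, p ^ n.factorization p = n := by
    conv_rhs => rw [← Nat.prod_factorization_pow_eq_self hn]
    rw [Finsupp.prod, Nat.support_factorization]
  have hdvd : ∏ p ∈ S, p ^ n.factorization p ∣ n := by
    conv_rhs => rw [← hfull]
    exact Finset.prod_dvd_prod_of_subset _ _ _ hS
  have hpow : ∏ p ∈ S, (((p ^ n.factorization p : ℕ) : ℝ) ^ δ) ≤ (n : ℝ) ^ δ := by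
    rw [Real.finsetProd_rpow S (fun p => ((p ^ n.factorization p : ℕ) : ℝ))
      (fun p _ => Nat.cast_nonneg _)]
    refine Real.rpow_le_rpow (Finset.prod_nonneg fun p _ => Nat.cast_nonneg _) ?_ hδ.le
    rw [← Nat.cast_prod]
    exact_mod_cast Nat.le_of_dvd (Nat.pos_of_ne_zero hn) hdvd
  calc ((∏ p ∈ S, n.factorization p : ℕ) : ℝ)
      ≤ (∏ p ∈ S, M p) * ∏ p ∈ S, (((p ^ n.factorization p : ℕ) : ℝ) ^ δ) := hprod
    _ ≤ (∏ q ∈ Finset.range P, M q) * (n : ℝ) ^ δ :=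
        mul_le_mul hMS hpow (Finset.prod_nonneg fun _ _ => Real.rpow_nonneg (Nat.cast_nonneg _) _)
          (Finset.prod_nonneg fun q _ => zero_le_one.trans (hM1 q))

/-! ### §2 `T(E) ≤ A_δ |Δ_min|^δ` -/

/-- **The geometric Tamagawa product is sub-polynomial in the minimal discriminant**: for every
`δ > 0` there is `A > 0` with `T(E) = ∏_{p ∥ N} ord_p(Δ_min) ≤ A · |Δ_min(E)|^δ` for every elliptic
`E/ℚ` (the multiplicative primes are prime factors of `|Δ_min|`, by `radical_conductorNorm_eq_holds`).
[folklore] -/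
theorem valuationProduct_le_rpow_minimalDiscriminantNorm {δ : ℝ} (hδ : 0 < δ) :
    ∃ A : ℝ, 0 < A ∧ ∀ (W : WeierstrassCurve ℚ) [W.IsElliptic],
      ((∏ p ∈ (W.conductorNorm ℤ).primeFactors with ¬ p ^ 2 ∣ W.conductorNorm ℤ,
          (W.minimalDiscriminantNorm ℤ).factorization p : ℕ) : ℝ)
        ≤ A * ((W.minimalDiscriminantNorm ℤ : ℕ) : ℝ) ^ δ := by
  obtain ⟨A, hA, h⟩ := prod_factorization_le_rpow hδ
  refine ⟨A, hA, fun W _ => ?_⟩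
  have hD0 : 0 < W.minimalDiscriminantNorm ℤ := W.minimalDiscriminantNorm_pos_holds
  have hrad : UniqueFactorizationMonoid.radical (W.conductorNorm ℤ) =
      UniqueFactorizationMonoid.radical (W.minimalDiscriminantNorm ℤ) :=
    W.radical_conductorNorm_eq_holds
  have hpf : (W.conductorNorm ℤ).primeFactors = (W.minimalDiscriminantNorm ℤ).primeFactors := by
    rw [← Nat.primeFactors_radical, hrad, Nat.primeFactors_radical]
  refine h _ hD0.ne' _ (fun p hp => ?_)
  rw [← hpf]
  exact (Finset.mem_filter.mp hp).1

/-! ### §3 Polynomial Szpiro on a class ⟹ `T ≤ C_ε N^ε` on that class -/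

/-- **Entropy from energy.** If `|Δ_min(E)| ≤ C · N_E^K` for every elliptic curve `E/ℚ` in a class
`P`, then for every `ε > 0` there is `C'` with `T(E) ≤ C' · N_E^ε` on `P`
(`T ≤ A_δ |Δ_min|^δ` with `δ = ε / max(K,1)`). [folklore] -/
theorem valuationProduct_le_of_polySzpiro {P : WeierstrassCurve ℚ → Prop} {K C : ℝ}
    (hS : ∀ (W : WeierstrassCurve ℚ) [W.IsElliptic], P W →
      ((W.minimalDiscriminantNorm ℤ : ℕ) : ℝ) ≤ C * ((W.conductorNorm ℤ : ℕ) : ℝ) ^ K) :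
    ∀ ε : ℝ, 0 < ε → ∃ C' : ℝ, ∀ (W : WeierstrassCurve ℚ) [W.IsElliptic], P W →
      ((∏ p ∈ (W.conductorNorm ℤ).primeFactors with ¬ p ^ 2 ∣ W.conductorNorm ℤ,
          (W.minimalDiscriminantNorm ℤ).factorization p : ℕ) : ℝ)
        ≤ C' * ((W.conductorNorm ℤ : ℕ) : ℝ) ^ ε := by
  intro ε hε
  set K' : ℝ := max K 1 with hK'
  have hK'pos : 0 < K' := lt_of_lt_of_le one_pos (le_max_right _ _)
  set C₀ : ℝ := max C 0 with hC₀
  have hδ : 0 < ε / K' := div_pos hε hK'pos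
  obtain ⟨A, hA, hT⟩ := valuationProduct_le_rpow_minimalDiscriminantNorm hδ
  refine ⟨A * C₀ ^ (ε / K'), fun W _ hW => ?_⟩
  have hN1 : (1 : ℝ) ≤ ((W.conductorNorm ℤ : ℕ) : ℝ) := by
    have h0 : 0 < W.conductorNorm ℤ := W.conductorNorm_pos_holds
    exact_mod_cast h0
  have hN0 : (0 : ℝ) ≤ ((W.conductorNorm ℤ : ℕ) : ℝ) := zero_le_one.trans hN1
  have hΔ : ((W.minimalDiscriminantNorm ℤ : ℕ) : ℝ) ≤ C₀ * ((W.conductorNorm ℤ : ℕ) : ℝ) ^ K' :=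
    calc ((W.minimalDiscriminantNorm ℤ : ℕ) : ℝ) ≤ C * ((W.conductorNorm ℤ : ℕ) : ℝ) ^ K := hS W hW
      _ ≤ C₀ * ((W.conductorNorm ℤ : ℕ) : ℝ) ^ K :=
          mul_le_mul_of_nonneg_right (le_max_left _ _) (Real.rpow_nonneg hN0 _)
      _ ≤ C₀ * ((W.conductorNorm ℤ : ℕ) : ℝ) ^ K' :=
          mul_le_mul_of_nonneg_left (Real.rpow_le_rpow_of_exponent_le hN1 (le_max_left _ _))
            (le_max_right _ _)
  have hΔ0 : (0 : ℝ) ≤ ((W.minimalDiscriminantNorm ℤ : ℕ) : ℝ) := Nat.cast_nonneg _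
  have hKε : K' * (ε / K') = ε := by field_simp
  calc ((∏ p ∈ (W.conductorNorm ℤ).primeFactors with ¬ p ^ 2 ∣ W.conductorNorm ℤ,
          (W.minimalDiscriminantNorm ℤ).factorization p : ℕ) : ℝ)
      ≤ A * ((W.minimalDiscriminantNorm ℤ : ℕ) : ℝ) ^ (ε / K') := hT W
    _ ≤ A * (C₀ * ((W.conductorNorm ℤ : ℕ) : ℝ) ^ K') ^ (ε / K') :=
        mul_le_mul_of_nonneg_left (Real.rpow_le_rpow hΔ0 hΔ hδ.le) hA.le
    _ = A * C₀ ^ (ε / K') * ((W.conductorNorm ℤ : ℕ) : ℝ) ^ ε := by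
        rw [Real.mul_rpow (le_max_right _ _) (Real.rpow_nonneg hN0 _), ← Real.rpow_mul hN0, hKε]
        ring

/-! ### §4 r3′ ⟹ polynomial Szpiro on the curves semistable away from `2` -/

/-- **Weighted Szpiro bootstraps to polynomial Szpiro.** `WeightedSzpiroBound` (r3′ of the route,
stmt-ABC-3272: `max(|Δ(W₀)|, |c₄(W₀)|³) ≤ C_ε (N·T)^{6+ε}` for global minimal `W₀` semistable away
from `2`) implies `|Δ_min(E)| ≤ C · N_E^{14}` for every elliptic `E/ℚ` semistable away from `2`:
take a global minimal equation `W₀` of `E` over `ℤ` (`exists_baseChange_int_forall_isMinimalAt`),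
so that `|Δ_min| = |Δ(W₀)|`, use r3′ at `ε = 1` and `T ≤ A |Δ_min|^{1/14}` (§2) to get
`|Δ_min| ≤ C₁ A⁷ N⁷ |Δ_min|^{1/2}`, and square. (Card `Ideas/weighted-szpiro-bootstrap.md`, lemma B2,
with the trivial entropy bound replaced by §2.) [folklore] -/
theorem polySzpiro_of_weightedSzpiroBound (h : WeightedSzpiroBound) :
    ∃ C : ℝ, ∀ (W : WeierstrassCurve ℚ) [W.IsElliptic],
      (∀ p : ℕ, p.Prime → p ≠ 2 → ¬ p ^ 2 ∣ W.conductorNorm ℤ) →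
      ((W.minimalDiscriminantNorm ℤ : ℕ) : ℝ) ≤ C * ((W.conductorNorm ℤ : ℕ) : ℝ) ^ (14 : ℝ) := by
  obtain ⟨C₁, hC₁⟩ := h 1 one_pos
  obtain ⟨A, hA, hT⟩ := valuationProduct_le_rpow_minimalDiscriminantNorm
    (δ := 1 / 14) (by norm_num)
  set C₀ : ℝ := max C₁ 0 with hC₀def
  have hC₀ : 0 ≤ C₀ := le_max_right _ _
  refine ⟨(C₀ * A ^ 7) ^ 2, fun W _ hss => ?_⟩
  -- a global minimal equation over `ℤ`
  obtain ⟨Cv, W₀, hCW, hmin⟩ := W.exists_baseChange_int_forall_isMinimalAt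
  have hΔ0 : W₀.Δ ≠ 0 := by
    intro h0
    have h1 : (Cv • W).Δ = 0 := by
      simp [hCW, WeierstrassCurve.baseChange, WeierstrassCurve.map_Δ, h0]
    exact (Cv • W).isUnit_Δ.ne_zero h1
  haveI := WeierstrassCurve.isElliptic_baseChange_int W₀ hΔ0
  have hN : (W₀.baseChange ℚ).conductorNorm ℤ = W.conductorNorm ℤ := by
    rw [← hCW, WeierstrassCurve.conductorNorm_smul_rat]
  have hDm : (W₀.baseChange ℚ).minimalDiscriminantNorm ℤ = W.minimalDiscriminantNorm ℤ := by
    rw [← hCW, WeierstrassCurve.minimalDiscriminantNorm_smul_rat]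
  have hDabs : W.minimalDiscriminantNorm ℤ = W₀.Δ.natAbs := by
    rw [← hDm, WeierstrassCurve.minimalDiscriminantNorm_eq_natAbs_holds W₀ hΔ0 hmin]
  have hss₀ : ∀ p : ℕ, p.Prime → p ≠ 2 → ¬ p ^ 2 ∣ (W₀.baseChange ℚ).conductorNorm ℤ := by
    rw [hN]; exact hss
  have key := hC₁ W₀ inferInstance hmin hss₀
  rw [hN, hDm] at key
  -- the quantities of `W`
  have hTle := hT W
  have hN1 : (1 : ℝ) ≤ ((W.conductorNorm ℤ : ℕ) : ℝ) := by
    have h0 : 0 < W.conductorNorm ℤ := W.conductorNorm_pos_holds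
    exact_mod_cast h0
  have hD1 : (1 : ℝ) ≤ ((W.minimalDiscriminantNorm ℤ : ℕ) : ℝ) := by
    have h0 : 0 < W.minimalDiscriminantNorm ℤ := W.minimalDiscriminantNorm_pos_holds
    exact_mod_cast h0
  have hDΔ : ((|W₀.Δ| : ℤ) : ℝ) = ((W.minimalDiscriminantNorm ℤ : ℕ) : ℝ) := by
    rw [hDabs, Nat.cast_natAbs]
  have hmax : ((|W₀.Δ| : ℤ) : ℝ) ≤ ((max |W₀.Δ| (|W₀.c₄| ^ 3) : ℤ) : ℝ) := by
    exact_mod_cast le_max_left _ _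
  set N : ℝ := ((W.conductorNorm ℤ : ℕ) : ℝ) with hNdef
  set D : ℝ := ((W.minimalDiscriminantNorm ℤ : ℕ) : ℝ) with hDdef
  set T : ℝ := ((∏ p ∈ (W.conductorNorm ℤ).primeFactors with ¬ p ^ 2 ∣ W.conductorNorm ℤ,
      (W.minimalDiscriminantNorm ℤ).factorization p : ℕ) : ℝ) with hTdef
  have hN0 : 0 ≤ N := zero_le_one.trans hN1
  have hD0 : 0 < D := lt_of_lt_of_le one_pos hD1
  have hT0 : 0 ≤ T := by rw [hTdef]; exact Nat.cast_nonneg _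
  have hNT : 0 ≤ N * T := mul_nonneg hN0 hT0
  -- step 1: `D ≤ C₀ (N T)^7`
  have h7 : ((6 : ℝ) + 1) = ((7 : ℕ) : ℝ) := by norm_num
  have hstep1 : D ≤ C₀ * (N * T) ^ (7 : ℕ) :=
    calc D = ((|W₀.Δ| : ℤ) : ℝ) := hDΔ.symm
      _ ≤ ((max |W₀.Δ| (|W₀.c₄| ^ 3) : ℤ) : ℝ) := hmax
      _ ≤ C₁ * (N * T) ^ ((6 : ℝ) + 1) := key
      _ ≤ C₀ * (N * T) ^ ((6 : ℝ) + 1) :=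
          mul_le_mul_of_nonneg_right (le_max_left _ _) (Real.rpow_nonneg hNT _)
      _ = C₀ * (N * T) ^ (7 : ℕ) := by rw [h7, Real.rpow_natCast]
  -- step 2: `(N T)^7 ≤ N^7 A^7 D^{1/2}`
  have hhalf : (D ^ (1 / 14 : ℝ)) ^ (7 : ℕ) = D ^ (1 / 2 : ℝ) := by
    rw [← Real.rpow_natCast, ← Real.rpow_mul hD0.le]
    norm_num
  have hstep2 : (N * T) ^ (7 : ℕ) ≤ N ^ (7 : ℕ) * (A ^ 7 * D ^ (1 / 2 : ℝ)) := by
    rw [mul_pow]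
    refine mul_le_mul_of_nonneg_left ?_ (pow_nonneg hN0 _)
    calc T ^ 7 ≤ (A * D ^ (1 / 14 : ℝ)) ^ 7 := pow_le_pow_left₀ hT0 hTle 7
      _ = A ^ 7 * D ^ (1 / 2 : ℝ) := by rw [mul_pow, hhalf]
  -- step 3: divide by `D^{1/2}` and square
  have hsq : D ^ (1 / 2 : ℝ) * D ^ (1 / 2 : ℝ) = D := by
    rw [← Real.rpow_add hD0]
    norm_num
  have hDhalf : 0 < D ^ (1 / 2 : ℝ) := Real.rpow_pos_of_pos hD0 _
  have hK0 : 0 ≤ C₀ * A ^ 7 * N ^ (7 : ℕ) := by positivity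
  have hcomb : D ≤ (C₀ * A ^ 7 * N ^ (7 : ℕ)) * D ^ (1 / 2 : ℝ) :=
    calc D ≤ C₀ * (N * T) ^ (7 : ℕ) := hstep1
      _ ≤ C₀ * (N ^ (7 : ℕ) * (A ^ 7 * D ^ (1 / 2 : ℝ))) := mul_le_mul_of_nonneg_left hstep2 hC₀
      _ = (C₀ * A ^ 7 * N ^ (7 : ℕ)) * D ^ (1 / 2 : ℝ) := by ring
  have hroot : D ^ (1 / 2 : ℝ) ≤ C₀ * A ^ 7 * N ^ (7 : ℕ) := by
    refine le_of_mul_le_mul_right ?_ hDhalf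
    calc D ^ (1 / 2 : ℝ) * D ^ (1 / 2 : ℝ) = D := hsq
      _ ≤ (C₀ * A ^ 7 * N ^ (7 : ℕ)) * D ^ (1 / 2 : ℝ) := hcomb
  calc D = D ^ (1 / 2 : ℝ) * D ^ (1 / 2 : ℝ) := hsq.symm
    _ ≤ (C₀ * A ^ 7 * N ^ (7 : ℕ)) * (C₀ * A ^ 7 * N ^ (7 : ℕ)) :=
        mul_le_mul hroot hroot hDhalf.le hK0
    _ = (C₀ * A ^ 7) ^ 2 * N ^ (14 : ℕ) := by ring
    _ = (C₀ * A ^ 7) ^ 2 * N ^ (14 : ℝ) := by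
        rw [show (14 : ℝ) = ((14 : ℕ) : ℝ) by norm_num, Real.rpow_natCast]

end ManyPrimeValuationProduct

/-! ### §5 The bootstrap: r3′ alone implies r2 and r4 -/

/-- **Bootstrap (card `weighted-szpiro-bootstrap`, asked for by crux triage r1-1/r1-2/r1-3).**
The rank-3 crux `WeightedSzpiroBound` (stmt-ABC-3272) ALONE implies both valuation-product cruxes
`ManyPrimeValuationProduct` (r2, stmt-ABC-1561) and `FewPrimeValuationProduct` (r4, stmt-ABC-1563)
of route-ABC-RibetTakahashiSplit: r3′ ⟹ `|Δ_min| ≤ C N^{14}` on the curves semistable away from `2`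
(§4) ⟹ `T(E) ≤ C_ε N^ε` there (§3); the cardinality hypotheses on the odd multiplicative primes are
not used. Consequence for the route: r2 and r4 are not load-bearing — the deciding theorem can be
re-cut as `WeightedSzpiroBound → Assembly → ABC`. [folklore] -/
theorem weightedSzpiroBound_bootstrap :
    Summit.ABC.ABC.Theses.RibetTakahashiSplit.WeightedSzpiroBound →
      Summit.ABC.ABC.Theses.RibetTakahashiSplit.ManyPrimeValuationProduct ∧
        Summit.ABC.ABC.Theses.RibetTakahashiSplit.FewPrimeValuationProduct := by
  intro h
  obtain ⟨C, hC⟩ := ManyPrimeValuationProduct.polySzpiro_of_weightedSzpiroBound h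
  have main := ManyPrimeValuationProduct.valuationProduct_le_of_polySzpiro
    (P := fun W => ∀ p : ℕ, p.Prime → p ≠ 2 → ¬ p ^ 2 ∣ W.conductorNorm ℤ) (K := 14) (C := C)
    (fun W _ hW => hC W hW)
  unfold ManyPrimeValuationProduct FewPrimeValuationProduct
  refine ⟨fun ε hε => ?_, fun ε hε => ?_⟩
  · obtain ⟨C', hC'⟩ := main ε hε
    exact ⟨C', fun W _ hss _ => hC' W hss⟩
  · obtain ⟨C', hC'⟩ := main ε hε
    exact ⟨C', fun W _ hss _ => hC' W hss⟩

/-- r3′ ⟹ r2 (first half of the bootstrap). [folklore] -/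
theorem manyPrimeValuationProduct_of_weightedSzpiroBound (h : WeightedSzpiroBound) :
    ManyPrimeValuationProduct :=
  (weightedSzpiroBound_bootstrap h).1

/-- r3′ ⟹ r4 (second half of the bootstrap). [folklore] -/
theorem fewPrimeValuationProduct_of_weightedSzpiroBound (h : WeightedSzpiroBound) :
    FewPrimeValuationProduct :=
  (weightedSzpiroBound_bootstrap h).2

/-! ### §6 Szpiro ⟹ crux, ABC ⟹ crux -/

/-- **Szpiro's conjecture implies r2 and r4** (conditional on the OPEN conjecture
`Literature.NumberTheory.EllipticCurves.SzpiroConjecture`, used at `ε = 1`: `|Δ_min| ≤ C N⁷` for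
every `E/ℚ`, then §3 with the trivial class). de Weger / Hindry direction of Pasten's remark after
Conj. 1.14 (arXiv:1705.09251 p. 8), in the route's geometric normalisation. [folklore] -/
theorem manyPrime_and_fewPrime_of_szpiro (h : SzpiroConjecture) :
    ManyPrimeValuationProduct ∧ FewPrimeValuationProduct := by
  obtain ⟨C, hC⟩ := h 1 one_pos
  have main := ManyPrimeValuationProduct.valuationProduct_le_of_polySzpiro
    (P := fun _ => True) (K := (6 : ℝ) + 1) (C := C) (fun W _ _ => hC W)
  unfold ManyPrimeValuationProduct FewPrimeValuationProduct
  refine ⟨fun ε hε => ?_, fun ε hε => ?_⟩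
  · obtain ⟨C', hC'⟩ := main ε hε
    exact ⟨C', fun W _ _ _ => hC' W trivial⟩
  · obtain ⟨C', hC'⟩ := main ε hε
    exact ⟨C', fun W _ _ _ => hC' W trivial⟩

/-- **The summit implies the crux**: `ABC → ManyPrimeValuationProduct ∧ FewPrimeValuationProduct`,
through the tree's discharged `szpiro_of_abcLe_holds` (Silverman AEC VIII.11.5(b): abc ⟹ Szpiro)
and `manyPrime_and_fewPrime_of_szpiro`. So r2/r4 admit no truth-level refutation short of `¬ ABC`
(crux disprover, Disproof.lean v4 §2, re-derived here so that it is importable). [folklore] -/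
theorem manyPrime_and_fewPrime_of_abc (h : _root_.ABC) :
    ManyPrimeValuationProduct ∧ FewPrimeValuationProduct := by
  refine manyPrime_and_fewPrime_of_szpiro (szpiro_of_abcLe_holds fun ε hε => ?_)
  obtain ⟨C, -, hC⟩ := (ABC_iff.mp h) ε hε
  exact ⟨C, fun a b c habc => (hC a b c habc).le⟩

/-- `ABC → ManyPrimeValuationProduct`. [folklore] -/
theorem manyPrimeValuationProduct_of_abc (h : _root_.ABC) : ManyPrimeValuationProduct :=
  (manyPrime_and_fewPrime_of_abc h).1

/-- `ABC → FewPrimeValuationProduct`. [folklore] -/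
theorem fewPrimeValuationProduct_of_abc (h : _root_.ABC) : FewPrimeValuationProduct :=
  (manyPrime_and_fewPrime_of_abc h).2

end Summit.ABC.ABC.Theorems
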